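import Summits.ResolutionOfSingularities.ResolutionOfSingularities.Theorems.WildQuotientResolution.Negative.CuspAlgebra
import Literature.AlgebraicGeometry.Resolution.ProjectiveSpaceRegular

/-!
# `WildQuotientResolution` — negative lemmas I(b): the cusp model; two natural strengthenings are false

Support (negative) lemmas for crux `stmt-ResolutionOfSingularities-15640`
(`Summit.ResolutionOfSingularities.ResolutionOfSingularities.Theses.WildQuotients.WildQuotientResolution`:
for every prime `p` and field `k` of characteristic `p`, every integral separated finite-type
`X₁ / k` receiving a finite surjective generically étale `q : X' → X₁` from a REGULAR integral `X'`,
invariant under an action `ρ : G →* Aut X'` of a finite group whose orbits are the fibres of `q`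
("`X₁ = X'/G` up to normalisation"), has a resolution of singularities), filed by the standing
disprover (cdisprove gen 1; work file `Cruxes/WildQuotientResolution/Disproof.lean`). This file
declares NO definition (the cusp algebra is written `Algebra.adjoin k {T², T³} ⊆ k[T]` inline) and NO
declaration concludes the route decl positively.

THE MODEL. Over every field `k`: `X' = Spec k[T]` (regular, integral), `X₁ = Spec k[T², T³]` (the
cuspidal cubic `y² = x³`: integral, separated, of finite type), `q` = the normalisation
`Spec k[T] → Spec k[T², T³]` (finite, surjective, INJECTIVE on points, an isomorphism — hence
étale — over the dense open `D(T²)`), `G = 1` acting trivially (invariance trivial; fibres = orbits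
because `q` is injective). So all ELEVEN hypotheses of the crux are met (`cusp_model`), while

* `X₁` is NOT regular (`not_isRegular_Spec`: regular local rings are normal — Matsumura 19.4, in
  tree as `isIntegrallyClosed_of_isRegularLocalRing` — normality is local, and `k[T², T³]` is not
  normal: `(T²)² ∣ (T³)²` but `T² ∤ T³`, against `IsIntegrallyClosed.pow_dvd_pow_iff`);
* `q` is NOT an isomorphism (`not_isIso_q`), i.e. `X₁` is not `X'/G = X'` on the nose — the
  phrase "up to normalisation" in the crux is sharp already for `G = 1`;
* yet `q` itself IS a resolution of `X₁` (`isResolution_q`) — the model is no counterexample.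

CONSEQUENCES (refuted natural strengthenings of the crux, at every prime):
* `not_wqIsRegular_at` / `not_wqIsRegular` — "… ⇒ `X₁` is regular" (no blow-up / normalisation
  needed) is FALSE: the hypotheses do not force regularity of the quotient, any proof must resolve.
* `not_wqIsIso_at` / `not_wqIsIso` — "… ⇒ `q` is an isomorphism" (the typed datum presents `X₁`
  as the quotient scheme itself) is FALSE: fibres = orbits + generic étaleness pin `X₁` only up to
  a finite universal homeomorphism; `X₁` need not be normal.

The commutative algebra (conductor trick `awayMap_bijective_of_forall_mul_mem`, membership
criterion, non-normality, finiteness, injectivity on primes) is in `Negative/CuspAlgebra.lean`; with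
Mathlib's `SpecMapRestrictBasicOpenIso` the conductor trick gives `IsIso (q ∣_ D(T²))`.

## Sources
* H. Matsumura, *Commutative Ring Theory*, CUP 1986, Thm. 19.4 (regular local ⇒ normal).
* The Stacks Project, Tag 02IS (regular schemes), Tag 01RN (birational), Tag 035E/0BXR
  (normalisation; the cusp `k[t², t³] ⊂ k[t]` is the standard example, conductor `(t²)`).
* R. Hartshorne, *Algebraic Geometry*, GTM 52, I Ex. 3.2 / II Ex. 3.8 (the cuspidal cubic and its
  normalisation, a bijective finite birational morphism that is not an isomorphism).
-/

noncomputable section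

-- single-problem summit: the doubled namespace component `ResolutionOfSingularities` is forced
set_option linter.dupNamespace false

open CategoryTheory AlgebraicGeometry TopologicalSpace Topology Polynomial
open Literature.AlgebraicGeometry.Resolution

namespace Summit.ResolutionOfSingularities.ResolutionOfSingularities.Theorems.WildQuotientResolution.Negative

variable (k : Type) [Field k]

/-! ### C. The cusp as an instance of the binders of `WildQuotientResolution` (with `G = 1`) -/

section Schemes

/-- `q : Spec k[T] → Spec k[T², T³]` is finite. -/
theorem isFinite_q : IsFinite (Spec.map (CommRingCat.ofHom
    (algebraMap (Algebra.adjoin k ({X ^ 2, X ^ 3} : Set k[X])) k[X]))) := by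
  rw [IsFinite.SpecMap_iff, CommRingCat.hom_ofHom, RingHom.finite_algebraMap]
  exact module_finite k

/-- `q` is surjective (integral extension). -/
theorem surjective_q : Function.Surjective (Spec.map (CommRingCat.ofHom
    (algebraMap (Algebra.adjoin k ({X ^ 2, X ^ 3} : Set k[X])) k[X]))).base := by
  haveI := algebra_isIntegral k
  haveI : FaithfulSMul (Algebra.adjoin k ({X ^ 2, X ^ 3} : Set k[X])) k[X] :=
    (faithfulSMul_iff_algebraMap_injective _ _).mpr Subtype.val_injective
  exact Algebra.IsIntegral.comap_surjective _ _

/-- `q` is injective on points. -/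
theorem injective_q : Function.Injective (Spec.map (CommRingCat.ofHom
    (algebraMap (Algebra.adjoin k ({X ^ 2, X ^ 3} : Set k[X])) k[X]))).base :=
  comap_injective k

/-- The localisation of `q` away from `T²` is an isomorphism of rings. -/
theorem awayMap_bijective : Function.Bijective (Localization.awayMap
    (algebraMap (Algebra.adjoin k ({X ^ 2, X ^ 3} : Set k[X])) k[X]) ⟨X ^ 2, X_sq_mem k⟩) :=
  awayMap_bijective_of_forall_mul_mem _ Subtype.val_injective _
    fun s => ⟨⟨s * X ^ 2, mul_X_sq_mem k s⟩, rfl⟩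

/-- `q` is an isomorphism over `D(T²)`. -/
theorem isIso_q_restrict : IsIso (Spec.map (CommRingCat.ofHom
    (algebraMap (Algebra.adjoin k ({X ^ 2, X ^ 3} : Set k[X])) k[X])) ∣_
      PrimeSpectrum.basicOpen (⟨X ^ 2, X_sq_mem k⟩ : Algebra.adjoin k ({X ^ 2, X ^ 3} : Set k[X]))) := by
  rw [← MorphismProperty.isomorphisms.iff,
    (MorphismProperty.isomorphisms Scheme).arrow_mk_iso_iff (SpecMapRestrictBasicOpenIso _ _),
    MorphismProperty.isomorphisms.iff]
  have heq : CommRingCat.ofHom (Localization.awayMap (CommRingCat.ofHom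
      (algebraMap (Algebra.adjoin k ({X ^ 2, X ^ 3} : Set k[X])) k[X])).hom ⟨X ^ 2, X_sq_mem k⟩) =
      (RingEquiv.ofBijective _ (awayMap_bijective k)).toCommRingCatIso.hom :=
    CommRingCat.hom_ext (RingHom.ext fun _ => rfl)
  rw [heq]
  infer_instance

/-- Hence `q` is étale over `D(T²)`. -/
theorem etale_q_restrict : Etale (Spec.map (CommRingCat.ofHom
    (algebraMap (Algebra.adjoin k ({X ^ 2, X ^ 3} : Set k[X])) k[X])) ∣_
      PrimeSpectrum.basicOpen (⟨X ^ 2, X_sq_mem k⟩ : Algebra.adjoin k ({X ^ 2, X ^ 3} : Set k[X]))) := by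
  haveI := isIso_q_restrict k
  infer_instance

/-- The generic point of the cusp lies in `D(T²)`. -/
theorem bot_mem_basicOpen :
    (⟨⊥, Ideal.isPrime_bot⟩ : PrimeSpectrum (Algebra.adjoin k ({X ^ 2, X ^ 3} : Set k[X]))) ∈
      PrimeSpectrum.basicOpen (⟨X ^ 2, X_sq_mem k⟩ : Algebra.adjoin k ({X ^ 2, X ^ 3} : Set k[X])) := by
  rw [PrimeSpectrum.mem_basicOpen]
  simp only [Submodule.mem_bot]
  exact fun h => pow_ne_zero 2 X_ne_zero (congrArg Subtype.val h)

/-- The generic point of the line lies over `D(T²)`. -/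
theorem bot_mem_preimage_basicOpen :
    (⟨⊥, Ideal.isPrime_bot⟩ : PrimeSpectrum k[X]) ∈ (Spec.map (CommRingCat.ofHom
      (algebraMap (Algebra.adjoin k ({X ^ 2, X ^ 3} : Set k[X])) k[X]))) ⁻¹ᵁ
        (PrimeSpectrum.basicOpen (⟨X ^ 2, X_sq_mem k⟩ : Algebra.adjoin k ({X ^ 2, X ^ 3} : Set k[X]))) := by
  show PrimeSpectrum.comap _ (⟨⊥, Ideal.isPrime_bot⟩ : PrimeSpectrum k[X]) ∈ PrimeSpectrum.basicOpen _
  rw [PrimeSpectrum.mem_basicOpen]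
  simp only [PrimeSpectrum.comap_asIdeal, Ideal.mem_comap, Submodule.mem_bot]
  exact pow_ne_zero 2 X_ne_zero

/-- The cusp is not a regular scheme. -/
theorem not_isRegular_Spec :
    ¬ Scheme.IsRegular (Spec (.of (Algebra.adjoin k ({X ^ 2, X ^ 3} : Set k[X])))) := by
  haveI := isNoetherianRing k
  rw [Scheme.isRegular_Spec_iff]
  exact not_isRegularRing k

/-- `Spec k[T², T³] → Spec k` is locally of finite type. -/
theorem locallyOfFiniteType_f : LocallyOfFiniteType (Spec.map (CommRingCat.ofHom
    (algebraMap k (Algebra.adjoin k ({X ^ 2, X ^ 3} : Set k[X]))))) := by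
  rw [HasRingHomProperty.Spec_iff (P := @LocallyOfFiniteType), CommRingCat.hom_ofHom,
    RingHom.finiteType_algebraMap]
  exact finiteType k

/-- `q` is not an isomorphism (`X₁` is singular, `X'` is regular). -/
theorem not_isIso_q : ¬ IsIso (Spec.map (CommRingCat.ofHom
    (algebraMap (Algebra.adjoin k ({X ^ 2, X ^ 3} : Set k[X])) k[X]))) := by
  intro h
  refine not_isRegular_Spec k fun x => ?_
  obtain ⟨y, rfl⟩ := surjective_q k x
  haveI := Scheme.isRegular_Spec (.of k[X]) y
  have e := (asIso ((Spec.map (CommRingCat.ofHom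
    (algebraMap (Algebra.adjoin k ({X ^ 2, X ^ 3} : Set k[X])) k[X]))).stalkMap y)).commRingCatIsoToRingEquiv
  exact IsRegularLocalRing.of_ringEquiv e.symm

/-- `q` is a resolution of the cusp (finite hence proper; an isomorphism over the dense `D(T²)`;
regular source): the `G = 1` slice of the crux is resolved by `q` itself. -/
theorem isResolution_q : IsResolution (Spec.map (CommRingCat.ofHom
    (algebraMap (Algebra.adjoin k ({X ^ 2, X ^ 3} : Set k[X])) k[X]))) := by
  haveI := isFinite_q k
  refine ⟨inferInstance, ⟨PrimeSpectrum.basicOpen ⟨X ^ 2, X_sq_mem k⟩, ?_, ?_, isIso_q_restrict k⟩,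
    Scheme.isRegular_Spec _⟩
  · exact (PrimeSpectrum.basicOpen _).isOpen.dense ⟨_, bot_mem_basicOpen k⟩
  · exact (Opens.isOpen _).dense ⟨_, bot_mem_preimage_basicOpen k⟩

/-- **The cusp model.** Over every field `k`, all eleven hypotheses of `WildQuotientResolution` are
met by `X' = Spec k[T]`, `X₁ = Spec k[T², T³]` (the cuspidal cubic), `q` the normalisation,
`G = 1`; and `X₁` is NOT regular, `q` is NOT an isomorphism, yet `q` is a resolution of `X₁`. -/
theorem cusp_model :
    ∃ (X' X₁ : Scheme.{0}) (f : X₁ ⟶ Spec (.of k)) (q : X' ⟶ X₁) (ρ : PUnit.{1} →* Aut X'),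
      IsSeparated f ∧ LocallyOfFiniteType f ∧ QuasiCompact f ∧ IsIntegral X₁ ∧ IsIntegral X' ∧
      Scheme.IsRegular X' ∧ IsFinite q ∧ Function.Surjective q.base ∧
      (∃ U : X₁.Opens, Dense (U : Set X₁) ∧ Etale (q ∣_ U)) ∧
      (∀ g : PUnit.{1}, (ρ g).hom ≫ q = q) ∧
      (∀ x y : X', q.base x = q.base y → ∃ g : PUnit.{1}, (ρ g).hom.base x = y) ∧
      ¬ Scheme.IsRegular X₁ ∧ ¬ IsIso q ∧ IsResolution q := by
  have h1 : ∀ g : PUnit.{1}, ((1 : PUnit.{1} →* Aut (Spec (.of k[X]))) g).hom = 𝟙 _ := fun _ => rfl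
  refine ⟨Spec (.of k[X]), Spec (.of (Algebra.adjoin k ({X ^ 2, X ^ 3} : Set k[X]))),
    Spec.map (CommRingCat.ofHom (algebraMap k _)),
    Spec.map (CommRingCat.ofHom (algebraMap (Algebra.adjoin k ({X ^ 2, X ^ 3} : Set k[X])) k[X])),
    1, inferInstance, locallyOfFiniteType_f k, inferInstance, inferInstance, inferInstance,
    Scheme.isRegular_Spec _, isFinite_q k, surjective_q k,
    ⟨PrimeSpectrum.basicOpen ⟨X ^ 2, X_sq_mem k⟩,
      (PrimeSpectrum.basicOpen _).isOpen.dense ⟨_, bot_mem_basicOpen k⟩, etale_q_restrict k⟩,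
    fun g => by rw [h1, Category.id_comp], fun x y hxy => ⟨1, ?_⟩, not_isRegular_Spec k,
    not_isIso_q k, isResolution_q k⟩
  rw [h1]
  exact injective_q k hxy

end Schemes


/-! ### D. Two natural strengthenings of the crux are false -/

/-- **Strengthening I is false at every prime: the quotient need not be regular.** With the
conclusion `Scheme.HasResolution X₁` of the crux replaced by `Scheme.IsRegular X₁` (i.e. "Galois-type
quotients of regular schemes are already regular, nothing to resolve"), the statement fails over
`𝔽_p` at the cusp model (`G = 1`). [folklore] -/
theorem not_wqIsRegular_at (p : ℕ) [Fact p.Prime] :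
    ¬ (∀ (k : Type) [Field k] [CharP k p] (X' X₁ : Scheme.{0}) (f : X₁ ⟶ Spec (.of k))
        (q : X' ⟶ X₁) (G : Type) [Group G] [Finite G] (ρ : G →* Aut X'),
        IsSeparated f → LocallyOfFiniteType f → QuasiCompact f → IsIntegral X₁ → IsIntegral X' →
        Scheme.IsRegular X' → IsFinite q → Function.Surjective q.base →
        (∃ U : X₁.Opens, Dense (U : Set X₁) ∧ Etale (q ∣_ U)) → (∀ g : G, (ρ g).hom ≫ q = q) →
        (∀ x y : X', q.base x = q.base y → ∃ g : G, (ρ g).hom.base x = y) →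
        Scheme.IsRegular X₁) := by
  intro h
  obtain ⟨X', X₁, f, q, ρ, hs, hl, hq, hi1, hi', hreg, hfin, hsurj, hU, hinv, horb, hnreg, -, -⟩ :=
    cusp_model (ZMod p)
  exact hnreg (h (ZMod p) X' X₁ f q PUnit ρ hs hl hq hi1 hi' hreg hfin hsurj hU hinv horb)

/-- Strengthening I, globally over all primes (the negation of the `∀ p` form). [folklore] -/
theorem not_wqIsRegular :
    ¬ (∀ p : ℕ, p.Prime → ∀ (k : Type) [Field k] [CharP k p] (X' X₁ : Scheme.{0})
        (f : X₁ ⟶ Spec (.of k)) (q : X' ⟶ X₁) (G : Type) [Group G] [Finite G] (ρ : G →* Aut X'),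
        IsSeparated f → LocallyOfFiniteType f → QuasiCompact f → IsIntegral X₁ → IsIntegral X' →
        Scheme.IsRegular X' → IsFinite q → Function.Surjective q.base →
        (∃ U : X₁.Opens, Dense (U : Set X₁) ∧ Etale (q ∣_ U)) → (∀ g : G, (ρ g).hom ≫ q = q) →
        (∀ x y : X', q.base x = q.base y → ∃ g : G, (ρ g).hom.base x = y) →
        Scheme.IsRegular X₁) :=
  fun h => haveI : Fact (Nat.Prime 2) := ⟨Nat.prime_two⟩; not_wqIsRegular_at 2 (h 2 Nat.prime_two)

/-- **Strengthening II is false at every prime: `X₁` is the quotient only up to normalisation.**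
With the conclusion replaced by `IsIso q` (for `G = 1` acting trivially this reads "`X₁ = X'/G` on
the nose"), the statement fails over `𝔽_p` at the cusp model: fibres = orbits, finiteness,
surjectivity and generic étaleness pin `X₁` down only up to a finite universal homeomorphism.
[folklore] -/
theorem not_wqIsIso_at (p : ℕ) [Fact p.Prime] :
    ¬ (∀ (k : Type) [Field k] [CharP k p] (X' X₁ : Scheme.{0}) (f : X₁ ⟶ Spec (.of k))
        (q : X' ⟶ X₁) (G : Type) [Group G] [Finite G] (ρ : G →* Aut X'),
        IsSeparated f → LocallyOfFiniteType f → QuasiCompact f → IsIntegral X₁ → IsIntegral X' →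
        Scheme.IsRegular X' → IsFinite q → Function.Surjective q.base →
        (∃ U : X₁.Opens, Dense (U : Set X₁) ∧ Etale (q ∣_ U)) → (∀ g : G, (ρ g).hom ≫ q = q) →
        (∀ x y : X', q.base x = q.base y → ∃ g : G, (ρ g).hom.base x = y) →
        IsIso q) := by
  intro h
  obtain ⟨X', X₁, f, q, ρ, hs, hl, hq, hi1, hi', hreg, hfin, hsurj, hU, hinv, horb, -, hniso, -⟩ :=
    cusp_model (ZMod p)
  exact hniso (h (ZMod p) X' X₁ f q PUnit ρ hs hl hq hi1 hi' hreg hfin hsurj hU hinv horb)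

/-- Strengthening II, globally over all primes. [folklore] -/
theorem not_wqIsIso :
    ¬ (∀ p : ℕ, p.Prime → ∀ (k : Type) [Field k] [CharP k p] (X' X₁ : Scheme.{0})
        (f : X₁ ⟶ Spec (.of k)) (q : X' ⟶ X₁) (G : Type) [Group G] [Finite G] (ρ : G →* Aut X'),
        IsSeparated f → LocallyOfFiniteType f → QuasiCompact f → IsIntegral X₁ → IsIntegral X' →
        Scheme.IsRegular X' → IsFinite q → Function.Surjective q.base →
        (∃ U : X₁.Opens, Dense (U : Set X₁) ∧ Etale (q ∣_ U)) → (∀ g : G, (ρ g).hom ≫ q = q) →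
        (∀ x y : X', q.base x = q.base y → ∃ g : G, (ρ g).hom.base x = y) →
        IsIso q) :=
  fun h => haveI : Fact (Nat.Prime 2) := ⟨Nat.prime_two⟩; not_wqIsIso_at 2 (h 2 Nat.prime_two)

end Summit.ResolutionOfSingularities.ResolutionOfSingularities.Theorems.WildQuotientResolution.Negative

end
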